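import Summits.QuantumFields.YangMills.Theorems.BalabanUVNodesN11NoExpansionGeneralStepCoPHOldBranch
import Literature.MathematicalPhysics.QuantumFieldTheory.Balaban1983to89.Node00.Record13SepCoPHChi
import Literature.MathematicalPhysics.QuantumFieldTheory.Balaban1983to89.Node00.Record13ResidualsRChi
import Summits.QuantumFields.YangMills.Theorems.BalabanUVNodesN11NoExpansionAtRecord13CoPChi
import Summits.QuantumFields.YangMills.Theorems.BalabanUVNodesN11NoExpansionDiagonalCoPHChi
import Summits.QuantumFields.YangMills.Theorems.BalabanUVNodesN11BackgroundScaleLocalChi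
import Summits.QuantumFields.YangMills.Theorems.BalabanUVNodesN11NoExpansionOldFactorsChi

/-!
# χ-GENERIC RE-ISSUE (WORK ORDER RC-1 «RE-CENTRE THE RECORD», director-ym №462 (B) ∕ №467 (D)) of `BalabanUVNodesN11NoExpansionGeneralStepCoPHOldBranch`

Cell `pub-ymgap` (HUMAN RULING D-0062, Track A), seat `pub-ymgap-dag-n11-d` (N11 [B14] s2; N11-σ campaign, `N11-G44-RC1-REACH-CENSUS.md`).  The CENTRE-TYPED
declarations of `BalabanUVNodesN11NoExpansionGeneralStepCoPHOldBranch` (those whose statement reads the (2.9) cut-off centre through `gOfRecord₁₃ ∕ EOfRecord₁₃ ∕ Provisos₁₃… ∕ T∕SLaw₁₃… ∕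
UbgOfRecord₁₃… ∕ WtOfRecord₁₃… ∕ datum∕tower∕coreOfRecord₁₃…`) RE-ISSUED VERBATIM in the β-slot `χ : ChiSlot F N` over [Ax-3b]∕[Ax-3c]∕[Ax-3d]'s χ-generic carriers
(`Node00/Record13Chi` ∕ `Record13CoPHChi` ∕ `Record13SepCoPHChi`): σ = (binder `(χ : ChiSlot F N)` after `θ`; Node00 defs `X ↦ XChi … χ`; Node00 rows `Y ↦ Y_chi`;
this lane's sibling modules `…Chi` for Summits-side dependencies); SAME short names in the sibling namespace `…BalabanUVNodesN11NoExpansionGeneralStepCoPHOldBranchChi` (consumers switch by namespace);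
the 3 centre-FREE declarations of the original are NOT copied — they are reused BY NAME (`open … (…)` below).  At `χ := chiβOfRecord₁₃ θ` every statement here is
DEFINITIONALLY the landed one ([Ax-3b]'s `rfl` receipts); at `χ := chiβOfRecord₁₃Ax θ` it is what the Ax-record's N11 machine reads.  Nothing of record edited (body-freeze №460 (2)).

HONEST FRAMING.  Count-neutral kernel re-elaboration of landed N11 bookkeeping∕estimates in a parameter; every HYPOTHESIS of the original stays a hypothesis; nothing of
Bałaban asserted beyond what the original file proves; N11 NOT discharged; K-items untouched; counts unmoved.  One finite `𝕋⁴_{L^K}` programme at fixed `ε = L^{−K}` —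
NOT ℝ⁴, NOT OS, NOT a mass gap, NOT Clay.  No `sorry`∕`instance`∕`notation`.  Sources: as the original module, plus [I] = [Balaban1987RG1] (2.9) p.266 (the cut-off's centre).
-/

noncomputable section

open MeasureTheory
open scoped BigOperators Matrix.Norms.L2Operator

namespace Summit.QuantumFields.YangMills.Theorems.BalabanUVNodesN11NoExpansionGeneralStepCoPHOldBranchChi

open Summit.QuantumFields.YangMills.Theorems.BalabanUVNodesN11NoExpansionGeneralStepCoPHOldBranch (clause_succ_CoPH_of_Omega_empty_of_pinChi_of_oldBranch_of_clause exists_clause_succ_CoPH_of_Omega_empty_of_sLaw₁₃CoPH_of_oldBranch clause_succ_CoPH_of_Omega_empty_of_levelFree_of_pinChi_of_oldBranch_of_clause)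
open Literature.MathematicalPhysics.QuantumFieldTheory.Balaban1983to89 T4Continuum Node00 Node00.Tk DagBinding
open B15DeterminingSets
open BalabanUVNodesN11NoExpansionZetaSpecSucc (noExpIntegrandAt_eq_zetaFactor_mul)
open BalabanUVNodesN11NoExpansionDiagonalAtZ (tkWeightsOfRecordP_ζ_apply tkWeightsOfRecordP_w_empty tkWeightsOfRecordP_ζ_local)
open BalabanUVNodesN11NoExpansionOldFactorsChi (oldFactors_agree_of_Omega_empty)
open BalabanUVNodesN11NoExpansionDiagonalCoPHChi (WtOfRecord₁₃H_eq_tkWeightsOfRecordP)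
open BalabanUVNodesN11NoExpansionGeneralStepCoPH (clause_succ_CoPH_of_Omega_empty_of_pinChi_of_provisos_of_clause tkWeightsOfRecordP_w_local_of_quad_local
  prefix_agree_of_levelFree_of_Omega_empty)

variable {F : T4Family} {N : ℕ} [NeZero N]

section OldBranch

variable (θ : Stage13HParams F N) (χ : ChiSlot F N) (p : B12.RunParams)

/-- **THE LEVEL-`k` FRONT FACTOR OF `init s′` IS MEASURABLE** from the v1.7 core provisos (row `measChi` one level down; constant `1` at `k = 0`).
[cite: Balaban1988Convergent, (2.17)–(2.18) p.257 (bookkeeping)] -/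
theorem measurable_chiSeqOfRecord_init (h : θ.Provisos₁₃CoPHChi F N χ) {k : ℕ} (hk : k < p.K)
    (s : SeqOfRecord F θ.ν θ.τ9.M (gOfRecord₁₃Chi F N θ.toStage13Params χ p) p.K (k + 1)) :
    Measurable (chiSeqOfRecord F N θ.ν θ.τ9.M (gOfRecord₁₃Chi F N θ.toStage13Params χ p) p.K k s.init) := by
  rcases Nat.eq_zero_or_pos k with hk0 | hkpos
  · subst hk0
    have : chiSeqOfRecord F N θ.ν θ.τ9.M (gOfRecord₁₃Chi F N θ.toStage13Params χ p) p.K 0 s.init = fun _ => 1 :=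
      funext fun U => chiSeqOfRecord_zero F N θ.ν θ.τ9.M _ p.K s.init U
    rw [this]
    exact measurable_const
  · obtain ⟨k', rfl⟩ : ∃ k', k = k' + 1 := ⟨k - 1, by omega⟩
    exact h.measChi p k' (by omega) s.init

/-- **THE NEW INTEGRAND IN CLOSED FORM UNDER THE PIN**: for a no-expansion `s′` and an old branch `S`, at every two-scale configuration `(U, V′)`,
`ζ_k(T)·w_k(∅,∅,∅)·𝐓_k(init s′,S)[e^{A_{k+1}(s′)}] (U, V′) = χ_k(init s′)(U)·w_k(s′)(U, Ū)·𝐓_k(init s′,S)[e^{A_k(init s′)}] (U)` — old factors agree (p543804), pin (V) and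
`quad_k(∅) = 0` on the two-scale configurations. [cite: Balaban1988Convergent, (3.24)–(3.25) p.270, (2.20)–(2.23) p.258] -/
theorem newIntegrand_eq_of_pinChi (hM : 1 ≤ θ.τ9.M) {k : ℕ}
    (s : SeqOfRecord F θ.ν θ.τ9.M (gOfRecord₁₃Chi F N θ.toStage13Params χ p) p.K (k + 1)) (hΩ : s.Ω (k + 1) = ∅)
    (hloc : (θ.zhAtChi χ p s).LocalLaws)
    (hqloc : ∀ j, j < k → ∀ ω ω' : MultiCfg (F.P p.K) (SU N) (FluctV N), (∀ i, i ≤ k → ω i = ω' i) →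
      (θ.zhAtChi χ p s).quad j (s.init.Λ (j + 1)) ω = (θ.zhAtChi χ p s).quad j (s.init.Λ (j + 1)) ω')
    (t : Sect2.TermValues (F.P p.K) (MatA N) (FluctV N) θ.τ9.M) (E₀ : ℝ) (S : ℕ → Set (Site (F.P p.K) 0))
    (hA : ∀ (a a' : Tk.MSFluct (F.P p.K) (FluctV N)) (Uf : GaugeField (F.P p.K) 0 (SU N)), (∀ i, i ≤ k → a i = a' i) →
      (sect2ActionDataOfRecord F N (FluctV N) p.K (settingOfRecord₁₃Chi F N θ.toStage13Params χ p) (θ.rzAtChi χ p s.init) s.init t (S, a) E₀).action23 k Uf =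
        (sect2ActionDataOfRecord F N (FluctV N) p.K (settingOfRecord₁₃Chi F N θ.toStage13Params χ p) (θ.rzAtChi χ p s.init) s.init t (S, a') E₀).action23 k Uf)
    (hZ : ∀ (V' : GaugeField (F.P p.K) (k + 1) (SU N)) (U₀ : GaugeField (F.P p.K) k (SU N)),
      (θ.zhAtChi χ p s).ζ0 k Set.univ (pairCfgAt (V := FluctV N) k V' U₀) =
        chiSeqOfRecord F N θ.ν θ.τ9.M (gOfRecord₁₃Chi F N θ.toStage13Params χ p) p.K k s.init U₀ *
          wOfRecord₉ F N θ.toStage9Params p (gOfRecord₁₃Chi F N θ.toStage13Params χ p) k s U₀ ((avOfRecord F N p.K k).avg U₀))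
    (hq : ∀ (V' : GaugeField (F.P p.K) (k + 1) (SU N)) (U₀ : GaugeField (F.P p.K) k (SU N)), (θ.zhAtChi χ p s).quad k ∅ (pairCfgAt (V := FluctV N) k V' U₀) = 0)
    (V' : GaugeField (F.P p.K) (k + 1) (SU N)) (U₀ : GaugeField (F.P p.K) k (SU N)) :
    noExpIntegrandAt F N (FluctV N) p.K k (WtOfRecord₁₃HChi F N θ χ p s)
        (tkBranchOfRecord F N (FluctV N) θ.ν θ.τ9.M _ p.K (WtOfRecord₁₃HChi F N θ χ p s) s.init S k
          (fun ω => sect2Operand F N (FluctV N) p.K (settingOfRecord₁₃Chi F N θ.toStage13Params χ p) (θ.rzAtChi χ p s) s t E₀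
            (UbgOfRecord₁₃CoPChi F N θ.toStage13Params χ p (k + 1) s) (S, fun j => (ω j).2) (fun j => (ω j).1)))
        V' U₀ =
      chiSeqOfRecord F N θ.ν θ.τ9.M (gOfRecord₁₃Chi F N θ.toStage13Params χ p) p.K k s.init U₀ *
        wOfRecord₉ F N θ.toStage9Params p (gOfRecord₁₃Chi F N θ.toStage13Params χ p) k s U₀ ((avOfRecord F N p.K k).avg U₀) *
        tkBranchOfRecord F N (FluctV N) θ.ν θ.τ9.M _ p.K (WtOfRecord₁₃HChi F N θ χ p s) s.init S k
          (fun ω => sect2Operand F N (FluctV N) p.K (settingOfRecord₁₃Chi F N θ.toStage13Params χ p) (θ.rzAtChi χ p s.init) s.init t E₀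
            (UbgOfRecord₁₃CoPChi F N θ.toStage13Params χ p k s.init) (S, fun j => (ω j).2) (fun j => (ω j).1))
          (baseCfg (V := FluctV N) k U₀) := by
  have hζloc : ∀ j, j < k → ∀ ω ω' : MultiCfg (F.P p.K) (SU N) (FluctV N), (∀ i, i ≤ k → ω i = ω' i) →
      (WtOfRecord₁₃HChi F N θ χ p s).ζ j (s.init.Ω (j + 1))ᶜ ω = (WtOfRecord₁₃HChi F N θ χ p s).ζ j (s.init.Ω (j + 1))ᶜ ω' :=
    fun _ hj ω ω' hh => hloc.localLaws₂.zeta0_local_lt hj _ ω ω' hh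
  have hwloc : ∀ j, j < k → ∀ ω ω' : MultiCfg (F.P p.K) (SU N) (FluctV N), (∀ i, i ≤ k → ω i = ω' i) →
      (WtOfRecord₁₃HChi F N θ χ p s).w j (s.init.Λ (j + 1)) ((s.init.Λ (j + 1))ᶜ ∩ s.init.Ω (j + 1)) (S (j + 1)) ω =
        (WtOfRecord₁₃HChi F N θ χ p s).w j (s.init.Λ (j + 1)) ((s.init.Λ (j + 1))ᶜ ∩ s.init.Ω (j + 1)) (S (j + 1)) ω' :=
    fun j hj ω ω' hh => tkWeightsOfRecordP_w_local_of_quad_local (θ.zhAtChi χ p s) hj _ _ _ (hqloc j hj) ω ω' hh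
  rw [noExpIntegrandAt_eq_zetaFactor_mul,
    oldFactors_agree_of_Omega_empty θ.toStage13Params χ p hM s hΩ (WtOfRecord₁₃HChi F N θ χ p s) hζloc S hwloc (θ.rzAtChi χ p s.init) (θ.rzAtChi χ p s)
      t E₀ E₀ hA V' U₀, sub_self, Real.exp_zero, one_mul,
    WtOfRecord₁₃H_eq_tkWeightsOfRecordP, tkWeightsOfRecordP_ζ_apply, tkWeightsOfRecordP_w_empty, hq, mul_zero, Real.exp_zero, mul_one, hZ]

end OldBranch

end Summit.QuantumFields.YangMills.Theorems.BalabanUVNodesN11NoExpansionGeneralStepCoPHOldBranchChi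

end
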